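import Summits.Ventures.DiscreteObjects.PP12.FlagExteriorPencil
import Summits.Ventures.DiscreteObjects.PP12.OrbitStructureOrderThree

/-!
# Point census of sides and T-lines of a flag-type collineation of order 3 (kernel; Step D groundwork for the orbit-matrix reductions)
Framing: lottery ticket; floor = certified bounds/negative ranges.

Cell pub-namedobj (venture DiscreteObjects), target (M), designs gen 13. Flag setting as in `FlagExterior`: `σ³ = 1`, all fixed points on
the fixed line `l`, all fixed lines through the fixed point `c ∈ l`. The orbit-matrix reductions (`FlagTenOrbitReduction`,
`FlagSevenOrbitReduction`; roadmap in HOME FAMILY-FLAG7X §7) evaluate the plane-level identities of `OrbitSideIdentities` on the points of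
a SIDE (a line through `Q, σQ`, `Q` exterior) and of a T-LINE (a line `≠ l` through a fixed point `y ≠ c`). This file records that census:
* `tline_not_fixed`, `tline_inter_l`, `tline_inter_fixedLine`, `c_not_mem_tline` — a T-line `b ∋ y` is not fixed, meets `l` only in `y`,
  and meets every fixed line `m ≠ l` in exactly one point, which is not fixed;
* `tline_orbit_simple` — a T-line meets every point orbit at most once (from `card_orb3_inter_le_one_of_fixed_mem`);
* `card_orb3_inter_cline_le_one`, `cline_map` — an exterior orbit-triangle has at most one vertex on any non-fixed line through `c`,
  and `σ` carries the c-line of `Q` to the c-line of `σQ`;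
* `nofixed_inter_fixedLine` — a line without fixed points (a side) meets every fixed line in exactly one point (not fixed, `≠ c`);
* `own_sides_ne` — the two own sides `Q·σQ`, `Q·σ²Q` through an exterior point are distinct;
* order 12, `f = 10`: `existsUnique_foreign_side` — through every exterior point passes exactly ONE exterior line other than its two own
  sides (the definition of `φ` in the roadmap: '`i` is inscribed in `φ i`').
No `sorry`, no new axioms.
-/

namespace Summit.Ventures.DiscreteObjects.PP12

open Configuration Finset
open scoped Classical

namespace Collineation

variable {P L : Type*} [Membership P L] [ProjectivePlane P L] [Fintype P] [Fintype L] (σ : Collineation P L)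

section Flag

variable {l : L} {c : P} (hl : σ.onLines l = l) (hc : σ.onPoints c = c) (hcl : c ∈ l)
  (hP : ∀ p : P, σ.onPoints p = p → p ∈ l) (hL : ∀ m : L, σ.onLines m = m → c ∈ m)

/-! ### T-lines: lines `≠ l` through a fixed point `y ≠ c` -/

omit [Fintype P] [Fintype L] in
include hcl hP hL in
/-- A line `b ≠ l` through a fixed point `y ≠ c` is not fixed. -/
theorem tline_not_fixed {y : P} (hy : σ.onPoints y = y) (hyc : y ≠ c) {b : L} (hyb : y ∈ b) (hbl : b ≠ l) :
    σ.onLines b ≠ b := fun h =>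
  hbl ((Nondegenerate.eq_or_eq (hL b h) hyb hcl (hP y hy)).resolve_left hyc.symm)

omit [Fintype P] [Fintype L] in
include hcl hP in
/-- `c` is not on a T-line. -/
theorem c_not_mem_tline {y : P} (hy : σ.onPoints y = y) (hyc : y ≠ c) {b : L} (hyb : y ∈ b) (hbl : b ≠ l) : c ∉ b :=
  fun hcb => hbl ((Nondegenerate.eq_or_eq hcb hyb hcl (hP y hy)).resolve_left hyc.symm)

omit [Fintype P] [Fintype L] in
include hP in
/-- The only fixed point of a T-line `b ∋ y` (`b ≠ l`) is `y`; equivalently its only point on `l` is `y`. -/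
theorem tline_fixed_point_eq {y : P} (hy : σ.onPoints y = y) {b : L} (hyb : y ∈ b) (hbl : b ≠ l) {q : P} (hqb : q ∈ b)
    (hq : σ.onPoints q = q) : q = y :=
  (Nondegenerate.eq_or_eq hqb hyb (hP q hq) (hP y hy)).resolve_right hbl

omit [Fintype P] [Fintype L] in
include hP in
/-- A T-line meets `l` exactly in `y`. -/
theorem tline_inter_l {y : P} (hy : σ.onPoints y = y) {b : L} (hyb : y ∈ b) (hbl : b ≠ l) {q : P} (hqb : q ∈ b) (hql : q ∈ l) :
    q = y :=
  (Nondegenerate.eq_or_eq hqb hyb hql (hP y hy)).resolve_right hbl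

omit [Fintype P] [Fintype L] in
include hcl hP hL in
/-- A T-line meets a fixed line `m ≠ l` in exactly one point, and that point is neither fixed nor `c`. -/
theorem tline_inter_fixedLine {y : P} (hy : σ.onPoints y = y) (hyc : y ≠ c) {b : L} (hyb : y ∈ b) (hbl : b ≠ l)
    {m : L} (hm : σ.onLines m = m) (hml : m ≠ l) :
    ∃ w : P, w ∈ b ∧ w ∈ m ∧ σ.onPoints w ≠ w ∧ w ≠ c ∧ ∀ w' : P, w' ∈ b → w' ∈ m → w' = w := by
  have hbm : b ≠ m := fun e => σ.tline_not_fixed hcl hP hL hy hyc hyb hbl (e ▸ hm)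
  obtain ⟨w, hwb, hwm⟩ : ∃ w : P, w ∈ b ∧ w ∈ m := ⟨HasPoints.mkPoint hbm, (HasPoints.mkPoint_ax hbm).1, (HasPoints.mkPoint_ax hbm).2⟩
  have huniq : ∀ w' : P, w' ∈ b → w' ∈ m → w' = w := fun w' h1 h2 =>
    (Nondegenerate.eq_or_eq h1 hwb h2 hwm).resolve_right hbm
  have hwc : w ≠ c := fun e => σ.c_not_mem_tline hcl hP hy hyc hyb hbl (e ▸ hwb)
  have hwf : σ.onPoints w ≠ w := by
    intro hwfix
    -- a fixed point of b is y; but y ∉ m (else m ∋ y, c ⇒ m = l)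
    have hwy : w = y := σ.tline_fixed_point_eq hP hy hyb hbl hwb hwfix
    rw [hwy] at hwm
    exact hml ((Nondegenerate.eq_or_eq hwm (hL m hm) (hP y hy) hcl).resolve_left hyc)
  exact ⟨w, hwb, hwm, hwf, hwc, huniq⟩

omit [Fintype P] [Fintype L] in
include hcl hP hL in
/-- A T-line meets every point orbit in at most one point (`σ³ = 1`). -/
theorem tline_orbit_simple (hq : σ.onPoints ^ 3 = 1) {y : P} (hy : σ.onPoints y = y) (hyc : y ≠ c) {b : L} (hyb : y ∈ b)
    (hbl : b ≠ l) (q : P) : ((orb3 σ.onPoints q).filter fun q' => q' ∈ b).card ≤ 1 :=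
  σ.card_orb3_inter_le_one_of_fixed_mem hq (σ.tline_not_fixed hcl hP hL hy hyc hyb hbl) hy hyb q

/-! ### Exterior orbit-triangles and the lines through `c` -/

omit [Fintype P] [Fintype L] in
include hc in
/-- An exterior orbit-triangle has at most one vertex on any non-fixed line through `c` (two vertices would make the line a side, but
sides carry no fixed point). More generally: a line through the fixed point `c` that is not fixed meets every orbit at most once. -/
theorem card_orb3_inter_cline_le_one (hq : σ.onPoints ^ 3 = 1) {u : L} (hcu : c ∈ u) (hu : σ.onLines u ≠ u) (q : P) :
    ((orb3 σ.onPoints q).filter fun q' => q' ∈ u).card ≤ 1 :=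
  σ.card_orb3_inter_le_one_of_fixed_mem hq hu hc hcu q

omit [ProjectivePlane P L] [Fintype P] [Fintype L] in
include hc in
/-- The c-line of `σQ` is the image of the c-line of `Q`: if `Q ∈ u ∋ c` then `σQ ∈ σu ∋ c`. -/
theorem cline_map {u : L} (hcu : c ∈ u) {Q : P} (hQu : Q ∈ u) : c ∈ σ.onLines u ∧ σ.onPoints Q ∈ σ.onLines u :=
  ⟨by have := σ.mem_map hcu; rwa [hc] at this, σ.mem_map hQu⟩

/-! ### Sides and other lines without fixed points -/

omit [Fintype P] [Fintype L] in
include hc hL in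
/-- A line carrying no fixed point (e.g. a side) meets every fixed line `m` in exactly one point, and that point is not fixed
(in particular `≠ c`). With `m = l` this is the 'Z-point' of a side, with `m ≠ l` its 'T-point' on `m`. -/
theorem nofixed_inter_fixedLine {a : L} (ha0 : ∀ p : P, σ.onPoints p = p → p ∉ a) {m : L} (hm : σ.onLines m = m) :
    ∃ w : P, w ∈ a ∧ w ∈ m ∧ σ.onPoints w ≠ w ∧ w ≠ c ∧ ∀ w' : P, w' ∈ a → w' ∈ m → w' = w := by
  have ham : a ≠ m := fun e => ha0 c hc (e ▸ hL m hm)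
  obtain ⟨w, hwa, hwm⟩ : ∃ w : P, w ∈ a ∧ w ∈ m :=
    ⟨HasPoints.mkPoint ham, (HasPoints.mkPoint_ax ham).1, (HasPoints.mkPoint_ax ham).2⟩
  exact ⟨w, hwa, hwm, fun h => ha0 w h hwa, fun e => ha0 w (e ▸ hc) hwa,
    fun w' h1 h2 => (Nondegenerate.eq_or_eq h1 hwa h2 hwm).resolve_right ham⟩

omit [Fintype P] [Fintype L] in
/-- The two own sides through an exterior point `Q` (`σ³ = 1`): `Q·σQ` and `Q·σ²Q` are distinct lines. -/
theorem own_sides_ne (hq : σ.onPoints ^ 3 = 1) {Q : P} (hQ : σ.onPoints Q ≠ Q) (hQX : ∀ m : L, σ.onLines m = m → Q ∉ m)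
    {s₁ s₂ : L} (h1 : Q ∈ s₁) (h1' : σ.onPoints Q ∈ s₁) (h2' : σ.onPoints (σ.onPoints Q) ∈ s₂) : s₁ ≠ s₂ := by
  intro e; rw [e] at h1 h1'
  exact (σ.orbit_triangle hq hQ hQX).2.2.2 s₂ h1 h1' h2'

section OrderTwelve

variable (h12 : ProjectivePlane.order P L = 12)

include hl hP h12 in
/-- **Order 12, `f = 10`: the unique foreign side.** Through an exterior point `Q` pass exactly three exterior lines
(`exterior_lines_through_eq_three`): its two own sides `Q·σQ`, `Q·σ²Q` and exactly ONE further exterior line — a side of another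
triangle `φ(i)` ('triangle `i` is inscribed in `φ i`', the map `φ` of `FlagTenOrbitData`). -/
theorem existsUnique_foreign_side (hq : σ.onPoints ^ 3 = 1) (hf : fixedCard σ.onPoints = 10) {Q : P}
    (hQX : ∀ m : L, σ.onLines m = m → Q ∉ m) :
    ∃ x : L, (Q ∈ x ∧ (∀ p : P, σ.onPoints p = p → p ∉ x) ∧ σ.onPoints Q ∉ x ∧ σ.onPoints (σ.onPoints Q) ∉ x) ∧
      ∀ x' : L, (Q ∈ x' ∧ (∀ p : P, σ.onPoints p = p → p ∉ x') ∧ σ.onPoints Q ∉ x' ∧ σ.onPoints (σ.onPoints Q) ∉ x') → x' = x := by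
  have hQ : σ.onPoints Q ≠ Q := σ.not_fixed_of_exterior_flag hl hP hQX
  have h3 := σ.exterior_lines_through_eq_three h12 hf hQX
  set E : Finset L := univ.filter fun x : L => Q ∈ x ∧ ∀ p : P, σ.onPoints p = p → p ∉ x with hE
  -- the two own sides
  have hne1 : Q ≠ σ.onPoints Q := fun e => hQ e.symm
  have hne2 : Q ≠ σ.onPoints (σ.onPoints Q) := fun e => (σ.sq_ne_of_cube hq hQ).1 e.symm
  set s₁ : L := HasLines.mkLine hne1 with hs₁
  set s₂ : L := HasLines.mkLine hne2 with hs₂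
  have hs₁m : Q ∈ s₁ ∧ σ.onPoints Q ∈ s₁ := HasLines.mkLine_ax hne1
  have hs₂m : Q ∈ s₂ ∧ σ.onPoints (σ.onPoints Q) ∈ s₂ := HasLines.mkLine_ax hne2
  have hs₁E : s₁ ∈ E := mem_filter.2 ⟨mem_univ _, hs₁m.1, (σ.side_no_fixed_point hQ hQX hs₁m.1 hs₁m.2).2⟩
  -- s₂ is the side through σ²Q and σ(σ²Q) = Q of the same orbit
  have h3Q : σ.onPoints (σ.onPoints (σ.onPoints Q)) = Q := apply_three σ.onPoints hq Q
  have hσσQ : σ.onPoints (σ.onPoints (σ.onPoints Q)) ≠ σ.onPoints (σ.onPoints Q) := by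
    rw [h3Q]; exact fun e => hne2 e
  have hσσQX : ∀ m : L, σ.onLines m = m → σ.onPoints (σ.onPoints Q) ∉ m := fun m hm h =>
    hQX m hm (by rw [← h3Q]; exact (σ.mem_fixedLine_iff hm _).2 h)
  have hs₂E : s₂ ∈ E := by
    refine mem_filter.2 ⟨mem_univ _, hs₂m.1, ?_⟩
    have := σ.side_no_fixed_point (Q := σ.onPoints (σ.onPoints Q)) hσσQ hσσQX hs₂m.2 (by rw [h3Q]; exact hs₂m.1)
    exact this.2
  have hs12 : s₁ ≠ s₂ := σ.own_sides_ne hq hQ hQX hs₁m.1 hs₁m.2 hs₂m.2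
  -- characterisation: an exterior line through Q avoiding σQ, σ²Q is an element of E other than s₁, s₂
  have key : ∀ x : L, (Q ∈ x ∧ (∀ p : P, σ.onPoints p = p → p ∉ x) ∧ σ.onPoints Q ∉ x ∧ σ.onPoints (σ.onPoints Q) ∉ x)
      ↔ x ∈ (E.erase s₁).erase s₂ := by
    intro x
    rw [mem_erase, mem_erase, hE, mem_filter]
    constructor
    · rintro ⟨hQx, hx0, h1, h2⟩
      refine ⟨fun e => h2 (e ▸ hs₂m.2), fun e => h1 (e ▸ hs₁m.2), mem_univ _, hQx, hx0⟩
    · rintro ⟨hx2, hx1, -, hQx, hx0⟩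
      refine ⟨hQx, hx0, fun h => hx1 ?_, fun h => hx2 ?_⟩
      · exact (Nondegenerate.eq_or_eq hQx h hs₁m.1 hs₁m.2).resolve_left hne1
      · exact (Nondegenerate.eq_or_eq hQx h hs₂m.1 hs₂m.2).resolve_left hne2
  have hcard : ((E.erase s₁).erase s₂).card = 1 := by
    rw [card_erase_of_mem (mem_erase.2 ⟨fun e => hs12 e.symm, hs₂E⟩), card_erase_of_mem hs₁E, h3]
  obtain ⟨x, hx⟩ := card_eq_one.1 hcard
  refine ⟨x, (key x).2 (by rw [hx]; exact mem_singleton_self _), fun x' hx' => ?_⟩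
  have := (key x').1 hx'
  rw [hx, mem_singleton] at this
  exact this

end OrderTwelve

end Flag

end Collineation

end Summit.Ventures.DiscreteObjects.PP12
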